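import Summits.BirchSwinnertonDyer.BirchSwinnertonDyer.Theorems.CyclotomicUntwistCompanionShapeInvariance
import Summits.BirchSwinnertonDyer.BirchSwinnertonDyer.Theorems.CyclotomicUntwistCompanionShapeAtMostTwoLines
import HarnessLib

/-!
# The census column `nroots = numStableLinesAtThree W ∈ {0, 1, 2}` is an invariant of the
# `G_{ℚ₃}`-module `W[3]` (route `CyclotomicUntwist` seat `bsd-line-cycu-p2` g5, O6 lane V10; THEOREMS ONLY)

`numStableLinesAtThree W` (the number of `ℚ₃`-roots of `Ψ₃` = of `G_{ℚ₃}`-stable lines of `W[3]`) is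
`0` iff IRR, `1` iff one stable line, `2` iff SPLIT, and never more (`numStableLinesAtThree_le_two`,
p622175). Since each shape is a module invariant (`shapes_iff_of_isLocallyCongruentModThreeAt3`,
p619165), so is the count: `numStableLinesAtThree_eq_of_isLocallyCongruentModThreeAt3` /
`…_of_equivariant`. HONEST FRAMING: bookkeeping corollary; nothing about any particular curve is
asserted; BSD is not proved for any curve. References: [Serre1972] §1.11; [Cremona1997] §3.8.
-/

set_option linter.dupNamespace false

noncomputable section

open scoped Classical

namespace Summit.BirchSwinnertonDyer.BirchSwinnertonDyer.Theorems.CompanionShape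

open Polynomial WeierstrassCurve Literature.NumberTheory.EllipticCurves
  Summit.BirchSwinnertonDyer.Rank1Residual.Additive Summit.BirchSwinnertonDyer.Rank1Residual

variable (W : WeierstrassCurve ℚ) [W.IsElliptic]

/-- `numStableLinesAtThree W = 2 ↔ SPLIT`. [cite: Serre1972, §1.11] -/
theorem numStableLinesAtThree_eq_two_iff : O5.numStableLinesAtThree W = 2 ↔ ShapeSplitThree W := by
  refine ⟨fun h2 ↦ ?_, numStableLinesAtThree_eq_two_of_shapeSplitThree W⟩
  have hbc3 : (W.baseChange ℚ_[3]).Ψ₃ = (W.Ψ₃).map (algebraMap ℚ ℚ_[3]) := by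
    rw [WeierstrassCurve.baseChange, map_Ψ₃]
  have hne0 : (W.Ψ₃).map (algebraMap ℚ ℚ_[3]) ≠ 0 := by
    rw [← hbc3]; exact Ψ₃_ne_zero _ (by norm_num)
  unfold O5.numStableLinesAtThree at h2
  obtain ⟨a, b, hab, hs⟩ := Finset.card_eq_two.mp h2
  have hmem : ∀ x, x ∈ ((W.Ψ₃).map (algebraMap ℚ ℚ_[3])).roots.toFinset →
      ((W.baseChange ℚ_[3]).Ψ₃).IsRoot x := fun x hx ↦ by
    rw [hbc3]; exact (mem_roots hne0).mp (Multiset.mem_toFinset.mp hx)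
  exact ⟨a, b, hab, hmem a (by rw [hs]; simp), hmem b (by rw [hs]; simp)⟩

/-- **The three-way census column**: `numStableLinesAtThree W` is `0` (IRR), `1` (one stable line) or
`2` (SPLIT). [cite: Serre1972, §1.11] -/
theorem numStableLinesAtThree_cases :
    (O5.numStableLinesAtThree W = 0 ∧ ShapeIrrThree W) ∨
      (O5.numStableLinesAtThree W = 1 ∧ ∃ x₀, IsUniqueStableLineThree W x₀) ∨
      (O5.numStableLinesAtThree W = 2 ∧ ShapeSplitThree W) := by
  have hle := numStableLinesAtThree_le_two W
  rcases Nat.lt_or_ge (O5.numStableLinesAtThree W) 1 with h | h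
  · left
    have h0 : O5.numStableLinesAtThree W = 0 := by omega
    exact ⟨h0, (shapeIrrThree_iff_numStableLines_eq_zero W).mpr h0⟩
  · rcases Nat.lt_or_ge (O5.numStableLinesAtThree W) 2 with h' | h'
    · right; left
      have h1 : O5.numStableLinesAtThree W = 1 := by omega
      exact ⟨h1, (numStableLinesAtThree_eq_one_iff W).mp h1⟩
    · right; right
      have h2 : O5.numStableLinesAtThree W = 2 := by omega
      exact ⟨h2, (numStableLinesAtThree_eq_two_iff W).mp h2⟩

/-- **`nroots` is an invariant of the `G_{ℚ₃}`-module `W[3]`.** [cite: Serre1972, §1.11] -/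
theorem numStableLinesAtThree_eq_of_isLocallyCongruentModThreeAt3 (X : WeierstrassCurve ℚ) [X.IsElliptic]
    (h : O5.IsLocallyCongruentModThreeAt3 W X) :
    O5.numStableLinesAtThree W = O5.numStableLinesAtThree X := by
  obtain ⟨hirr, hsplit, -, -, -, -⟩ := shapes_iff_of_isLocallyCongruentModThreeAt3 W X h
  have hX := numStableLinesAtThree_le_two X
  rcases numStableLinesAtThree_cases W with ⟨h0, hI⟩ | ⟨h1, hU⟩ | ⟨h2, hS⟩
  · rw [h0, eq_comm, ← shapeIrrThree_iff_numStableLines_eq_zero]; exact hirr.mp hI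
  · rcases numStableLinesAtThree_cases X with ⟨h0', hI'⟩ | ⟨h1', -⟩ | ⟨h2', hS'⟩
    · obtain ⟨x₀, hx₀⟩ := hU
      exact ((hirr.mpr hI') x₀ hx₀.1).elim
    · rw [h1, h1']
    · obtain ⟨x₀, hx₀⟩ := hU
      obtain ⟨r, r', hne, hr, hr'⟩ := hsplit.mpr hS'
      exact (hne ((hx₀.2 r hr).trans (hx₀.2 r' hr').symm)).elim
  · rw [h2, eq_comm, numStableLinesAtThree_eq_two_iff]; exact hsplit.mp hS

/-- … in particular along a global mod-`3` congruence `W[3] ≅ X[3]`. [cite: Serre1972, §1.11] -/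
theorem numStableLinesAtThree_eq_of_equivariant (X : WeierstrassCurve ℚ) [X.IsElliptic]
    (e : geomTorsion W (3 : ℤ) ≃+ geomTorsion X (3 : ℤ))
    (he : ∀ (σ : Field.absoluteGaloisGroup ℚ) (P : geomTorsion W (3 : ℤ)), e (σ • P) = σ • e P) :
    O5.numStableLinesAtThree W = O5.numStableLinesAtThree X :=
  numStableLinesAtThree_eq_of_isLocallyCongruentModThreeAt3 W X
    (O5.isLocallyCongruentModThreeAt3_of_equivariant W X e he)

end Summit.BirchSwinnertonDyer.BirchSwinnertonDyer.Theorems.CompanionShape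

end
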